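import Literature.Computability.Cryptography.RegevReductionResiduals
import Literature.Computability.Cryptography.RegevReductionDGSLaws
import Literature.Computability.Cryptography.RegevReductionDGSBlocks
import Literature.Computability.Cryptography.RegevGIVPMachine
import HarnessLib

/-!
# Regev's quantum reduction, `GapSVP` form, V: Lemma 3.20 at machine level — residual B PROVED

Topic `Computability/Cryptography` (family `pqc`). Regev 2009, **Lemma 3.20** ("for any `γ = γ(n) ≥ 1`
there is a polynomial time reduction from `GapCVP′_{100√n γ(n)}` to `DGS_{√n γ(n)/λ₁(L*)}`", author's
version arXiv:2401.03703, p. 22, with the verifier `𝒱` of Aharonov–Regev 2005, §6) in its MACHINE FORM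
`Literature.Computability.Cryptography.regev2009_lemma_3_20_machine` — the named residual B of
`RegevReductionResiduals.lean`, verbatim hypothesis `hL` of `regev_lwe_to_gapSVP_quantum_of_dgs` and of
`regev_lwe_to_gapSVP_quantum_of_thm31_of_lemma320` — is PROVED here: `regev2009_lemma_3_20_machine_holds`.

The decider is the uniform poly-time quantum family
`Q = CWrap(⟨·, ε⟩, PolyCopiesIdx(CWrap(qIn, D, gcanon), K = 3000(|x'|+1)⁴ + 1), gOut)` (exactly the shape
of the `GIVP` machine of `RegevGIVPMachine.lean`, whose block lemmas `Regev2009.GIVPBlocks.*` are reused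
with the query extractor `Regev2009.Lemma320.qIn` of `RegevReductionDGSBlocks.lean`): on the code `x` of
`(B, t, d)` every copy `j < K` runs the `DGS` sampler `D` on the query `(L(adj(−B)ᵀ), |det B|/(100d))`
(`RegevQuery.queryF`, the integer form of `(L*, 1/(100d))`), the outer post-processor `gOut` decodes the
first `N = nSamples n = 3000(n+1)⁴` measured blocks into integer vectors `v₁, …, v_N` and outputs `1` iff
the machine form `ARVerifier.MAccepts` of `𝒱` REJECTS them (`gOut_eq_true_iff`). Correctness, eventually
in the dimension `n`:

* YES (`dist(t, L(B)) ≤ d`): `𝒱` is sound for every witness (`ARVerifier.not_mAccepts_of_infDist_le`,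
  Aharonov–Regev §6.1), so every branch outputs `1`: acceptance probability `1 ≥ 2/3`
  (`one_le_acceptProbOn_of_yes`).
* NO (`λ₁(L(B)) > 100√n γ d`, …): the query is admissible (`Lemma320.dgsBoundDual_queryInstance_lt`), so
  the law of each decoded vector is within `ν(n)` of `det(−B) · D_{L*, 1/(100d)}` (`Lemma320.target_eq_map`,
  `GIVPBlocks.map_readOff_kernel_eq`); the `K` measured blocks are independent
  (`PolyCopiesIdx.kernel_map_segments`) and well formed almost surely, and on well-formed blocks the
  reader of `gOut` reads the block (`blockStr_eq_fstF_segment`), so the `N` decoded vectors are i.i.d.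
  (`GIVPBlocks.indepLaw_map_block_eq_iidPMF`) within `N ν(n)` of the ideal tuple (hybrid argument,
  `LWE.abs_toReal_toOuterMeasure_iidPMF_sub_le`), which `𝒱` accepts with probability `≥ 0.829`
  (`Lemma320.ideal_accept_ge`, from `ARVerifier.le_measureReal_accepts_certOf_of_gapCVP'_no`, Aharonov–Regev
  §6.2 with Regev's `N`); hence `Q` accepts with probability `≤ 0.171 + N ν(n) ≤ 1/3` for large `n`
  (`kernelProb_copies_ge`, `acceptProbOn_le`, `eventually_nSamples_mul_le`).

Consequences: `regev_lwe_to_gapSVP_quantum_of_thm31` — pqc.S19 in its `GapSVP` form from Regev's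
Theorem 3.1 (machine `DGS` form, hypothesis `h₂` of `regev_lwe_to_sivp_quantum_of_h12`) ALONE; and
`regev_lwe_to_gapSVP_quantum_holds_of_oneSampleStage` — the same from the single named residual A
(`regev2009_thm_3_1_oneSampleStage`), on a par with the `SIVP` form `regev_lwe_to_sivp_quantum_holds_of`.

Everything is proved; no named facts, no new axioms.

## References

* O. Regev, *On lattices, learning with errors, random linear codes, and cryptography*, J. ACM 56
  (2009), art. 34; author's version arXiv:2401.03703, Lemma 3.20 and its proof (p. 22), §3.3. [Regev2009]
* D. Aharonov, O. Regev, *Lattice problems in NP ∩ coNP*, J. ACM 52 (2005) 749–765, §6 (the verifier `𝒱`),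
  §6.1 (soundness), §6.2 (completeness). [AharonovRegev2005]
* E. Bernstein, U. Vazirani, *Quantum complexity theory*, SIAM J. Comput. 26 (1997), §8 (classical
  computation inside quantum machines); C. H. Bennett, E. Bernstein, G. Brassard, U. Vazirani, *Strengths and
  weaknesses of quantum computing*, SIAM J. Comput. 26 (1997), Thm. 4.13–4.14. [BennettBernsteinBrassardVazirani1997]
* O. Goldreich, *Foundations of Cryptography I*, CUP 2001, §3.2.3 (hybrid argument). [Goldreich2001]
-/

noncomputable section

namespace Literature.Computability.Cryptography

namespace Regev2009.Lemma320Machine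

open _root_.Computability Filter Polynomial Literature.Computability.Complexity
  Literature.Computability.Complexity.Brick Literature.Computability.QuantumComplexity
  Literature.Probability.Distributions Literature.Algebra.EuclideanLattices
  Literature.Algebra.EuclideanLattices.FarCertMachine Regev2009.GMSSParallel
open scoped ENNReal

/-! ### The copies of the block and their layout -/

/-- **The copies of the block** are `K = 3000 (m+1)⁴ + 1` indexed copies on inputs `x' = ⟨x, ε⟩` of
length `m` (copy-count polynomial `3000 (X+1)⁴`), enough for the `N = 3000 (n+1)⁴` samples of the verifier.
[cite: Regev2009, Lemma 3.20 (proof: N = poly(n) calls)] -/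
theorem K_eq_of_pK {Pc : PolyCopies.Params} (hK : Pc.pK = C 3000 * (X + C 1) ^ 4) (m : ℕ) :
    PolyCopiesIdx.K Pc m = 3000 * (m + 1) ^ 4 + 1 := by
  rw [PolyCopiesIdx.K, hK]
  simp only [eval_mul, eval_C, eval_pow, eval_add, eval_X]

section Layout

variable (Pc : PolyCopies.Params) (I : LatticeInstance) (t : Fin I.n → ℤ) (d : ℚ)

/-- The copies' input `⟨x, ε⟩` has the length `n'` used by the block reader. [folklore] -/
theorem nIn0_eq : Lemma320.nIn0 I t d = (boolPair (codeOf I t d) []).length := by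
  rw [Lemma320.nIn0, hOut_apply]

/-- **Enough copies**: `N = nSamples n ≤ K`. [cite: Regev2009, Lemma 3.20 (proof)] -/
theorem nSamples_le_K {Pc : PolyCopies.Params} (hK : Pc.pK = C 3000 * (X + C 1) ^ 4) :
    ARVerifier.nSamples I.n ≤ PolyCopiesIdx.K Pc (boolPair (codeOf I t d) []).length := by
  rw [← nIn0_eq, K_eq_of_pK hK, ARVerifier.nSamples]
  have h := Lemma320.n_le_nIn0 I t d
  have := Nat.pow_le_pow_left (Nat.succ_le_succ h) 4
  have : 3000 * (I.n + 1) ^ 4 ≤ 3000 * (Lemma320.nIn0 I t d + 1) ^ 4 := Nat.mul_le_mul_left _ this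
  omega

/-- **On a well-formed segment the block reader reads the segment.** The raw code `blockStr j` (the
first component of the `b`-bit window of block `j`) is the first component of the measured content of
copy `j` (`PolyCopiesIdx.segment`, a prefix of that window, `PolyCopiesIdx.copy_fits`), whenever that
content starts with a framed code. [cite: Regev2009, Lemma 3.20 (proof: the j-th sample)] -/
theorem blockStr_eq_fstF_segment (Y : List Bool) (j : ℕ)
    (hwf : GIVPBlocks.WellFormed (PolyCopiesIdx.segment Pc (Lemma320.nIn0 I t d) Y j)) :
    Lemma320.blockStr Pc I t d Y j = fstF (PolyCopiesIdx.segment Pc (Lemma320.nIn0 I t d) Y j) := by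
  have hblk : PolyCopiesIdx.base Pc (Lemma320.nIn0 I t d) + PolyCopiesIdx.b Pc (Lemma320.nIn0 I t d) * j =
      PolyCopiesIdx.blk Pc (Lemma320.nIn0 I t d) j 0 := by
    rw [PolyCopiesIdx.blk, Nat.add_zero, Nat.mul_comm]
  have hpre : PolyCopiesIdx.segment Pc (Lemma320.nIn0 I t d) Y j <+:
      ((Y.drop (PolyCopiesIdx.base Pc (Lemma320.nIn0 I t d))).drop (PolyCopiesIdx.b Pc (Lemma320.nIn0 I t d) * j)).take
        (PolyCopiesIdx.b Pc (Lemma320.nIn0 I t d)) := by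
    rw [List.drop_drop, hblk, PolyCopiesIdx.segment]
    exact List.take_prefix_take_left (PolyCopiesIdx.copy_fits _)
  obtain ⟨r, hr⟩ := hpre
  rw [Lemma320.blockStr, ← hr, GIVPBlocks.fstF_append_of_wellFormed hwf]

/-- **The decoded sample vectors are the vectors read off the segments** when the first `N` segments are
well formed. [cite: Regev2009, Lemma 3.20 (proof: the samples w₁, …, w_N)] -/
theorem vecOf_eq_readOff (Y : List Bool)
    (hwf : ∀ j : Fin (ARVerifier.nSamples I.n), GIVPBlocks.WellFormed (PolyCopiesIdx.segment Pc (Lemma320.nIn0 I t d) Y j)) :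
    Lemma320.vecOf Pc I t d Y =
      fun j : Fin (ARVerifier.nSamples I.n) => GIVPBlocks.readOff I.n (PolyCopiesIdx.segment Pc (Lemma320.nIn0 I t d) Y j) := by
  funext j
  show decodeIntVec I.n (Lemma320.blockStr Pc I t d Y j) = decodeIntVec I.n (fstF _)
  rw [blockStr_eq_fstF_segment Pc I t d Y j (hwf j)]

end Layout

/-! ### Eventual smallness of the statistical error -/

/-- **`N ν(n) → 0`**: `3000 (n+1)⁴ ν(n) ≤ 487/3000` for all large `n` when `ν` is negligible.
[cite: Regev2009, Lemma 3.20 (proof: "with probability exponentially close to 1")] -/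
theorem eventually_nSamples_mul_le {ν : ℕ → ℝ} (hν : IsNegligible ν) :
    ∀ᶠ n : ℕ in atTop, (ARVerifier.nSamples n : ℝ) * ν n ≤ 487 / 3000 := by
  have h := (hν.polynomial_mul (Polynomial.C (3000 : ℝ) * (Polynomial.X + Polynomial.C 1) ^ 4)) 0
  simp only [pow_zero, one_mul] at h
  have h' : Tendsto (fun n : ℕ => (ARVerifier.nSamples n : ℝ) * ν n) atTop (nhds 0) := by
    refine h.congr' (Eventually.of_forall fun n => ?_)
    simp only [eval_mul, eval_C, eval_pow, eval_add, eval_X, ARVerifier.nSamples]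
    push_cast
    ring
  exact (h'.eventually (gt_mem_nhds (by norm_num : (0 : ℝ) < 487 / 3000))).mono fun n hn => hn.le

/-! ### The NO case: the copies make the verifier accept -/

/-- **The probability estimate of Lemma 3.20 (NO case) at machine level.** On a NO instance `(B, t, d)` of
`GapCVP′_{100√n γ}` (`γ ≥ 1`), if the sampler's output-vector law on the query `(L(adj(−B)ᵀ), |det B|/(100d))`
is within `ν` of the discrete Gaussian of that lattice at that width, then the measured string of the copies
makes the machine form of the Aharonov–Regev verifier accept the decoded vectors with probability at least
`0.829 − N ν`: the segments are independent (`PolyCopiesIdx.kernel_map_segments`), well formed almost surely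
and read by the block reader (`vecOf_eq_readOff`), the vectors read off them are i.i.d. with the sampler's
output-vector law (`GIVPBlocks.indepLaw_map_block_eq_iidPMF`, `GIVPBlocks.map_readOff_kernel_eq`), that law is
within `ν` of the scaled dual Gaussian `det(−B) · D_{L*, 1/(100d)}` (`Lemma320.target_eq_map`), and `N` ideal
samples are accepted with probability `≥ 0.829` (`Lemma320.ideal_accept_ge`); the hybrid argument
(`LWE.abs_toReal_toOuterMeasure_iidPMF_sub_le`) costs `N ν`.
[cite: Regev2009, Lemma 3.20 (proof, NO case, p. 22)] [cite: AharonovRegev2005, §6.2 (Completeness) — variant] -/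
theorem kernelProb_copies_ge {P : CWrap.Params} {D : UniformQCircuitFamily}
    (hP : GIVPBlocks.IsBlockParams P Lemma320.qIn D)
    {Pc : PolyCopies.Params} (hPcF : Pc.F = CWrap.family P) (hPcK : Pc.pK = C 3000 * (X + C 1) ^ 4)
    {γ : ℕ → ℝ} (hγ : ∀ n, 1 ≤ γ n) {I : LatticeInstance} {t : Fin I.n → ℤ} {d : ℚ}
    (hp : (((⟨I, t⟩ : CVPInstance), d) : GapCVPInstance) ∈ GapCVP'.no (fun k => 100 * Real.sqrt k * γ k))
    {ν : ℝ}
    (hν : (D.outputVectorLaw I.n (GapSVPInstance.encode (RegevQuery.queryInstance I, RegevQuery.queryWidth I d))).tvDist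
        ((discreteGaussian (RegevQuery.queryInstance I).lattice ((RegevQuery.queryWidth I d : ℚ) : ℝ) 0).map Subtype.val) ≤ ν) :
    829 / 1000 - (ARVerifier.nSamples I.n : ℝ) * ν ≤
      (PolyCopiesIdx.family Pc).kernelProb 0 (boolPair (codeOf I t d) [])
        {Y | ARVerifier.MAccepts I.basis t d (Lemma320.vecOf Pc I t d Y)} := by
  have hI : I.IsNonsingular := hp.1
  have hd : 0 < d := hp.2.1
  have hd0 : d ≠ 0 := ne_of_gt hd
  haveI : IsZLattice ℝ I.lattice := LatticeInstance.isZLattice_of_isNonsingular hI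
  set N := ARVerifier.nSamples I.n with hN
  have hm : Lemma320.nIn0 I t d = (boolPair (codeOf I t d) []).length := nIn0_eq I t d
  -- enough copies; the block of the first `N` coordinates
  have hNK : N ≤ PolyCopiesIdx.K Pc (boolPair (codeOf I t d) []).length := nSamples_le_K I t d hPcK
  obtain ⟨c, hK⟩ : ∃ c, PolyCopiesIdx.K Pc (boolPair (codeOf I t d) []).length = 0 + (N + c) :=
    ⟨PolyCopiesIdx.K Pc (boolPair (codeOf I t d) []).length - N, by omega⟩
  generalize hKdef : PolyCopiesIdx.K Pc (boolPair (codeOf I t d) []).length = K at hK hNK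
  set emb : Fin N → Fin K := fun j => Fin.cast hK.symm (Fin.natAdd 0 (Fin.castAdd c j)) with hemb_def
  have hemb : ∀ j, (emb j : ℕ) = j := fun j => by simp [emb]
  have hKc : PolyCopiesIdx.K Pc (boolPair (codeOf I t d) []).length = K := hKdef
  -- the law of the segments
  have hseg : ((PolyCopiesIdx.family Pc).kernel 0 (boolPair (codeOf I t d) [])).map
      (fun w => fun j : Fin K => PolyCopiesIdx.segment Pc (boolPair (codeOf I t d) []).length w j) =
      indepLaw K (fun j => PolyCopiesIdx.blockLaw Pc (boolPair (codeOf I t d) []) j) := by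
    have h := PolyCopiesIdx.kernel_map_segments (P := Pc) (boolPair (codeOf I t d) [])
    rw [← hKdef]
    exact h
  -- the events on the segments
  set readT : (Fin K → List Bool) → Fin N → EuclideanSpace ℝ (Fin I.n) :=
    fun s j => intVecToEuclidean I.n (GIVPBlocks.readOff I.n (s (emb j))) with hreadT
  set W : Set (Fin K → List Bool) := {s | ∀ j, GIVPBlocks.WellFormed (s (emb j))} with hW
  set E : Set (Fin K → List Bool) := readT ⁻¹' Lemma320.acceptE I t d with hE
  set S : Set (List Bool) := {Y | ARVerifier.MAccepts I.basis t d (Lemma320.vecOf Pc I t d Y)} with hS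
  -- (1) the deterministic half: well-formed segments reading an accepted tuple make the verifier accept
  have hdet : (fun w => fun j : Fin K => PolyCopiesIdx.segment Pc (boolPair (codeOf I t d) []).length w j) ⁻¹'
      (W ∩ E) ⊆ S := by
    rintro w ⟨hwW, hwE⟩
    have hwf : ∀ j : Fin N, GIVPBlocks.WellFormed (PolyCopiesIdx.segment Pc (Lemma320.nIn0 I t d) w j) := by
      intro j
      have h : GIVPBlocks.WellFormed
          (PolyCopiesIdx.segment Pc (boolPair (codeOf I t d) []).length w (emb j)) := hwW j
      rw [hemb, ← hm] at h
      exact h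
    have hwE' : readT (fun j : Fin K => PolyCopiesIdx.segment Pc (boolPair (codeOf I t d) []).length w j) ∈
        Lemma320.acceptE I t d := hwE
    simp only [Lemma320.acceptE, Set.mem_setOf_eq] at hwE'
    obtain ⟨v, hv, hEq⟩ := hwE'
    have hvec : Lemma320.vecOf Pc I t d w = v := by
      rw [vecOf_eq_readOff _ I t d w hwf]
      funext j
      apply intVecToEuclidean_injective I.n
      have hj := congrFun hEq j
      have e1 : readT (fun j : Fin K => PolyCopiesIdx.segment Pc (boolPair (codeOf I t d) []).length w j) j =
          intVecToEuclidean I.n (GIVPBlocks.readOff I.n (PolyCopiesIdx.segment Pc (Lemma320.nIn0 I t d) w j)) := by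
        show intVecToEuclidean I.n (GIVPBlocks.readOff I.n
          (PolyCopiesIdx.segment Pc (boolPair (codeOf I t d) []).length w (emb j))) = _
        rw [hemb, hm]
      rw [← e1, hj]
      rfl
    show ARVerifier.MAccepts I.basis t d (Lemma320.vecOf Pc I t d w)
    rw [hvec]
    exact hv
  -- the three laws
  set μ := (PolyCopiesIdx.family Pc).kernel 0 (boolPair (codeOf I t d) []) with hμ
  set Λ := indepLaw K (fun j => PolyCopiesIdx.blockLaw Pc (boolPair (codeOf I t d) []) j) with hΛ
  -- (2) ill-formed segments are null
  have hWnull : Λ.toOuterMeasure Wᶜ = 0 := by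
    have hsub : Wᶜ ⊆ ⋃ j : Fin N, {s : Fin K → List Bool | s (emb j) ∈ {z | ¬ GIVPBlocks.WellFormed z}} := by
      intro s hs
      have hs' : ¬ ∀ j, GIVPBlocks.WellFormed (s (emb j)) := hs
      push Not at hs'
      obtain ⟨j, hj⟩ := hs'
      exact Set.mem_iUnion.2 ⟨j, hj⟩
    refine le_antisymm ((MeasureTheory.measure_mono hsub).trans (le_of_eq ?_)) bot_le
    refine MeasureTheory.measure_iUnion_null fun j => ?_
    rw [hΛ, LWE.indepLaw_toOuterMeasure_apply_preimage, PolyCopiesIdx.blockLaw_eq_kernel, hPcF]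
    exact GIVPBlocks.toOuterMeasure_not_wellFormed_eq_zero hP _
  -- (3) the vectors read off the first `N` segments are iid with the sampler's output-vector law on the query
  have hlawT : Λ.map readT = LWE.iidPMF (D.outputVectorLaw I.n
      (GapSVPInstance.encode (RegevQuery.queryInstance I, RegevQuery.queryWidth I d))) N := by
    rw [hΛ]
    refine GIVPBlocks.indepLaw_map_block_eq_iidPMF hK _ (fun z => intVecToEuclidean I.n (GIVPBlocks.readOff I.n z)) _
      fun j => ?_
    rw [PolyCopiesIdx.blockLaw_eq_kernel, hPcF, PolyCopiesIdx.inputIdx, GIVPPost.boolPair_nil_append,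
      show (fun z => intVecToEuclidean I.n (GIVPBlocks.readOff I.n z)) = intVecToEuclidean I.n ∘ GIVPBlocks.readOff I.n from rfl,
      ← PMF.map_comp, GIVPBlocks.map_readOff_kernel_eq hP, Lemma320.qIn_apply, RegevQuery.queryF_codeOf I t d hd0,
      PMF.map_comp]
    rfl
  -- (4) the estimate for `N` samples of that law: hybrid to the ideal law, then the verifier's completeness
  set Θ := LWE.iidPMF (D.outputVectorLaw I.n
    (GapSVPInstance.encode (RegevQuery.queryInstance I, RegevQuery.queryWidth I d))) N with hΘ
  have hideal : (829 : ℝ) / 1000 ≤ ((LWE.iidPMF ((dualGaussian I.lattice (100 * (d : ℝ))).map (Lemma320.scaleDual I)) N).toOuterMeasure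
      (Lemma320.acceptE I t d)).toReal := Lemma320.ideal_accept_ge I t d hγ hp
  have htv : (D.outputVectorLaw I.n (GapSVPInstance.encode (RegevQuery.queryInstance I, RegevQuery.queryWidth I d))).tvDist
      ((dualGaussian I.lattice (100 * (d : ℝ))).map (Lemma320.scaleDual I)) ≤ ν := by
    rw [← Lemma320.target_eq_map I d hI hd]
    exact hν
  have hhyb := LWE.abs_toReal_toOuterMeasure_iidPMF_sub_le
    (D.outputVectorLaw I.n (GapSVPInstance.encode (RegevQuery.queryInstance I, RegevQuery.queryWidth I d)))
    ((dualGaussian I.lattice (100 * (d : ℝ))).map (Lemma320.scaleDual I)) N (Lemma320.acceptE I t d)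
  have hΘge : (829 : ℝ) / 1000 - N * ν ≤ (Θ.toOuterMeasure (Lemma320.acceptE I t d)).toReal := by
    have habs := abs_le.1 hhyb
    have hN0 : (0 : ℝ) ≤ N := Nat.cast_nonneg _
    have hmul := mul_le_mul_of_nonneg_left htv hN0
    linarith [habs.1, habs.2]
  -- (5) the chain of inequalities
  have hle1 : ∀ {Ω : Type} (μ : PMF Ω) (A : Set Ω), μ.toOuterMeasure A ≤ 1 := fun μ A =>
    (MeasureTheory.OuterMeasure.mono _ (Set.subset_univ _)).trans_eq ((PMF.toOuterMeasure_apply_eq_one_iff _ _).2 (Set.subset_univ _))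
  have h1 : Λ.toOuterMeasure (W ∩ E) ≤ μ.toOuterMeasure S := by
    rw [← hseg, PMF.toOuterMeasure_map_apply]
    exact MeasureTheory.OuterMeasure.mono _ hdet
  have h2 : Λ.toOuterMeasure E ≤ Λ.toOuterMeasure (W ∩ E) := by
    have := GIVPMachine.toOuterMeasure_le_inter_add_compl Λ E W
    rwa [hWnull, add_zero, Set.inter_comm] at this
  have h3 : Λ.toOuterMeasure E = Θ.toOuterMeasure (Lemma320.acceptE I t d) := by
    rw [← hlawT, PMF.toOuterMeasure_map_apply]
  -- (6) to real numbers
  rw [GIVPBlocks.kernelProb_eq_toReal]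
  show _ ≤ (μ.toOuterMeasure S).toReal
  have hmono := ENNReal.toReal_mono (ne_top_of_le_ne_top ENNReal.one_ne_top (hle1 _ _)) (h2.trans h1)
  rw [h3] at hmono
  linarith

/-! ### The outer wrap: acceptance probability versus the copies -/

/-- **The outer wrap, NO side**: the machine's acceptance probability on the code of `(B, t, d)` is at most
`1 −` the probability that the copies' measured string makes the verifier accept (on such strings the
post-processor outputs `0`, `Lemma320.gOut_eq_false_iff`; `CWrap.kernelProb_family_ge`).
[cite: BennettBernsteinBrassardVazirani1997, Thm. 4.14] [cite: Regev2009, Lemma 3.20 (proof: accept iff 𝒱 rejects)] -/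
theorem acceptProbOn_le {Pout : CWrap.Params} {Pc : PolyCopies.Params} (hh : Pout.h = hOut) (hgo : Pout.g = Lemma320.gOut Pc)
    {I : LatticeInstance} (hn : 1 ≤ I.n) (t : Fin I.n → ℤ) (d : ℚ) :
    (CWrap.family Pout).acceptProbOn 0 (codeOf I t d) ≤
      1 - Pout.F.kernelProb 0 (boolPair (codeOf I t d) []) {Y | ARVerifier.MAccepts I.basis t d (Lemma320.vecOf Pc I t d Y)} := by
  have h := CWrap.kernelProb_family_ge Pout (codeOf I t d)
    (fun _ => {Y | ARVerifier.MAccepts I.basis t d (Lemma320.vecOf Pc I t d Y)})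
  rw [hh, hgo, hOut_apply] at h
  have h' : Pout.F.kernelProb 0 (boolPair (codeOf I t d) []) {Y | ARVerifier.MAccepts I.basis t d (Lemma320.vecOf Pc I t d Y)} ≤
      (CWrap.family Pout).kernelProb 0 (codeOf I t d) HF := by
    refine h.trans (GIVPMachine.kernelProb_mono _ _ ?_)
    rintro z ⟨Y, hY, hz⟩
    have hg : Lemma320.gOut Pc (boolPair (codeOf I t d) Y) = [false] := (Lemma320.gOut_eq_false_iff Pc I t d Y hn).2 hY
    rw [hg] at hz
    obtain ⟨r, rfl⟩ := hz
    show ([false] ++ r).headD false = false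
    rfl
  rw [kernelProb_HF] at h'
  linarith

/-- **The outer wrap, YES side**: if `dist(t, L(B)) ≤ d`, `d > 0`, the machine accepts the code of
`(B, t, d)` with probability `1` (every measured string of the copies is rejected by the verifier,
`ARVerifier.not_mAccepts_of_infDist_le`, so the post-processor outputs `1`, `Lemma320.gOut_eq_true_iff`).
[cite: AharonovRegev2005, §6.1 (Soundness) — variant] [cite: Regev2009, Lemma 3.20 (proof, YES case)] -/
theorem one_le_acceptProbOn_of_yes {Pout : CWrap.Params} {Pc : PolyCopies.Params} (hh : Pout.h = hOut)
    (hgo : Pout.g = Lemma320.gOut Pc) {I : LatticeInstance} (hn : 1 ≤ I.n) {t : Fin I.n → ℤ} {d : ℚ} (hd : 0 < d)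
    (hdist : Metric.infDist (intVecToEuclidean I.n t) (I.lattice : Set (EuclideanSpace ℝ (Fin I.n))) ≤ d) :
    1 ≤ (CWrap.family Pout).acceptProbOn 0 (codeOf I t d) := by
  have h := CWrap.kernelProb_family_ge Pout (codeOf I t d) (fun _ => Set.univ)
  rw [hh, hgo, hOut_apply, GIVPMachine.kernelProb_eq_one_of_forall _ _ (fun w => Set.mem_univ w)] at h
  have h' : (1 : ℝ) ≤ (CWrap.family Pout).kernelProb 0 (codeOf I t d) HT := by
    refine h.trans (GIVPMachine.kernelProb_mono _ _ ?_)
    rintro z ⟨Y, -, hz⟩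
    have hg : Lemma320.gOut Pc (boolPair (codeOf I t d) Y) = [true] :=
      (Lemma320.gOut_eq_true_iff Pc I t d Y hn).2 (ARVerifier.not_mAccepts_of_infDist_le hd hdist _)
    rw [hg] at hz
    obtain ⟨r, rfl⟩ := hz
    show ([true] ++ r).headD false = true
    rfl
  rwa [kernelProb_HT] at h'

/-! ### Lemma 3.20 at machine level -/

/-- **Regev 2009, Lemma 3.20 (`GapCVP′_{100√n γ} ≤ DGS_{√n γ/λ₁(L*)}`) at machine level — residual B
(`regev2009_lemma_3_20_machine`) PROVED.** For every `γ ≥ 1`, every uniform poly-time quantum family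
sampling `DGS_{√n γ/λ₁(L*)}` up to a negligible statistical error yields the uniform poly-time quantum family
`CWrap(⟨·, ε⟩, PolyCopiesIdx(CWrap(qIn, D, gcanon), K = 3000(|x'|+1)⁴ + 1), gOut)` accepting the YES instances of
`GapCVP′_{100√n γ}` with probability `≥ 2/3` (`one_le_acceptProbOn_of_yes`) and the NO instances with
probability `≤ 1/3` (`kernelProb_copies_ge`, `acceptProbOn_le`, `eventually_nSamples_mul_le`, the query being
admissible by `Lemma320.dgsBoundDual_queryInstance_lt`), for all large dimensions.
[cite: Regev2009, Lemma 3.20 (p. 22)] [cite: AharonovRegev2005, §6] -/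
theorem lemma_3_20_machine : regev2009_lemma_3_20_machine := by
  intro γ hγ hDGS
  obtain ⟨D, ν, hν, hD⟩ := hDGS
  obtain ⟨P, hP⟩ := GIVPBlocks.exists_blockParams Lemma320.qIn_mem_FP D
  obtain ⟨pF, hpF⟩ := QCircuitFamily.IsUniform.isPolySize_holds (GIVPBlocks.block_isUniform hP)
  have hpF' : ∀ m, (CWrap.family P).ancillas m ≤ pF.eval m := fun m => (hpF m).2
  -- the copies: `3000 (m+1)⁴ + 1` indexed copies of the block
  obtain ⟨Pc, hPcF, hPcK⟩ : ∃ Pc : PolyCopies.Params, Pc.F = CWrap.family P ∧ Pc.pK = C 3000 * (X + C 1) ^ 4 :=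
    ⟨⟨CWrap.family P, pF, hpF', C 3000 * (X + C 1) ^ 4⟩, rfl, rfl⟩
  have hUc : (PolyCopiesIdx.family Pc).IsUniform :=
    PolyCopiesIdx.family_isUniform Pc (by rw [hPcF]; exact GIVPBlocks.block_isUniform hP)
  have hOc : (PolyCopiesIdx.family Pc).IsOracleFree :=
    PolyCopiesIdx.family_isOracleFree Pc (by rw [hPcF]; exact GIVPBlocks.block_isOracleFree hP)
  obtain ⟨Pout, hh, hgo, hF⟩ := CWrap.exists_params hOut_mem_FP (Lemma320.gOut_mem_FP (P := Pc)) hUc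
  refine ⟨⟨CWrap.family Pout, CWrap.family_isOracleFree Pout (by rw [hF]; exact hOc),
    CWrap.family_isUniform Pout (by rw [hF]; exact hUc)⟩, ?_⟩
  -- correctness, for all large dimensions
  unfold UniformQCircuitFamily.SamplesDGS at hD
  filter_upwards [hD, eventually_nSamples_mul_le hν, eventually_ge_atTop 1] with n hDn hνn hn1
  rintro ⟨⟨I, t⟩, d⟩ hIn
  have hIn' : I.n = n := hIn
  subst hIn'
  refine ⟨fun hyes => ?_, fun hno => ?_⟩
  · -- YES instances: acceptance probability `1`
    have hd : 0 < d := hyes.2.1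
    have hdist : Metric.infDist (intVecToEuclidean I.n t) (I.lattice : Set (EuclideanSpace ℝ (Fin I.n))) ≤ d := hyes.2.2
    show 2 / 3 ≤ (CWrap.family Pout).acceptProbOn 0 (codeOf I t d)
    have h1 := one_le_acceptProbOn_of_yes hh hgo hn1 hd hdist
    linarith
  · -- NO instances: acceptance probability `≤ 0.171 + N ν(n) ≤ 1/3`
    show (CWrap.family Pout).acceptProbOn 0 (codeOf I t d) ≤ 1 / 3
    have hI : I.IsNonsingular := hno.1
    have hd : 0 < d := hno.2.1
    have hfar : 100 * Real.sqrt I.n * γ I.n * (d : ℝ) < minNorm I.lattice := hno.2.2.1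
    have hJ := Lemma320.queryInstance_isNonsingular I hI
    have hlt := Lemma320.dgsBoundDual_queryInstance_lt I d (zero_le_one.trans (hγ I.n)) hI hd hfar
    have hνn' := hDn (RegevQuery.queryInstance I) (RegevQuery.queryWidth I d) rfl hJ hlt
    have hcop := kernelProb_copies_ge hP hPcF hPcK hγ hno hνn'
    have hwrap := acceptProbOn_le hh hgo hn1 t d (Pc := Pc)
    rw [hF] at hwrap
    linarith

end Regev2009.Lemma320Machine

/-! ### Residual B discharged; pqc.S19 (`GapSVP` form) from Theorem 3.1 alone -/

section Consequences

open Filter Literature.Computability.Complexity Literature.Computability.Cryptography.LWE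
  Literature.Algebra.EuclideanLattices

variable (q : ℕ → ℕ) [∀ n, NeZero (q n)] (α : ℕ → ℝ) (m : ℕ → ℕ)

/-- **Residual B of `RegevReductionResiduals.lean` is a theorem**: Regev 2009, Lemma 3.20 in machine form,
`regev2009_lemma_3_20_machine`, holds (`Regev2009.Lemma320Machine.lemma_3_20_machine`).
[cite: Regev2009, Lemma 3.20 (p. 22)] [cite: AharonovRegev2005, §6] -/
theorem regev2009_lemma_3_20_machine_holds : regev2009_lemma_3_20_machine :=
  Regev2009.Lemma320Machine.lemma_3_20_machine

/-- **pqc.S19, `GapSVP` form, from Regev's Theorem 3.1 (machine `DGS` form) ALONE** — hypothesis `hL`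
(Lemma 3.20) of `regev_lwe_to_gapSVP_quantum_of_thm31_of_lemma320` discharged by
`regev2009_lemma_3_20_machine_holds`; the remaining hypothesis is verbatim `h₂` of
`regev_lwe_to_sivp_quantum_of_h12` / `regev_lwe_to_sivp_quantum_of_worstCase`.
[cite: Regev2009, Theorem 1.1 (GapSVP) from Theorem 3.1, Lemma 3.20 and §3.3] -/
theorem regev_lwe_to_gapSVP_quantum_of_thm31
    (h₂ : ∀ (m' : ℕ → ℕ) (_ : IsPolyBounded m') (_ : IsPolyTimeParams q α m')
      (_ : ∀ᶠ n : ℕ in atTop, 0 < α n ∧ α n < 1 ∧ 2 * Real.sqrt n < α n * q n)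
      (_ : ∃ (W : UniformQCircuitFamily) (c : ℝ), 0 < c ∧
        W.SolvesSearchLWEWorstCase q (fun n => discretizedGaussian (q n) (α n)) m'
          fun n => (2 : ℝ) ^ (-(c * n)))
      (ε : ℕ → ℝ), IsNegligible ε → (∀ n, 0 < ε n) →
      ∃ (D : UniformQCircuitFamily) (ν : ℕ → ℝ), IsNegligible ν ∧ D.SamplesDGS (regevDGSBound α ε) ν) :
    regev_lwe_to_gapSVP_quantum q α m :=
  regev_lwe_to_gapSVP_quantum_of_thm31_of_lemma320 q α m h₂ regev2009_lemma_3_20_machine_holds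

/-- **pqc.S19, `GapSVP` form, from the single named residual A** (`regev2009_thm_3_1_oneSampleStage`, the
correctness of the assembled one-sample quantum stage of Lemma 3.14): the `GapSVP` twin of
`regev_lwe_to_sivp_quantum_holds_of`, by `regev_lwe_to_gapSVP_quantum_holds_of` with residual B now the theorem
`regev2009_lemma_3_20_machine_holds`.
[cite: Regev2009, Theorem 1.1 (GapSVP) from Theorem 3.1, Lemma 3.20 and §3.3] -/
theorem regev_lwe_to_gapSVP_quantum_holds_of_oneSampleStage (h : regev2009_thm_3_1_oneSampleStage q α) :
    regev_lwe_to_gapSVP_quantum q α m :=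
  regev_lwe_to_gapSVP_quantum_holds_of q α m h regev2009_lemma_3_20_machine_holds

end Consequences

end Literature.Computability.Cryptography

end
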